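import Mathlib
import HarnessLib
import Literature.MathematicalPhysics.StatisticalMechanics.LinearisedMapBlockPartABKM
import Literature.MathematicalPhysics.StatisticalMechanics.RenormalisationMapDecompositionABKM
import Literature.MathematicalPhysics.StatisticalMechanics.RenormalisationMapRemainderOne
import Literature.MathematicalPhysics.StatisticalMechanics.RenormalisationMapRemaindersFinal
import Literature.MathematicalPhysics.StatisticalMechanics.ReblockingCounting

/-!
# The renormalisation map `S(H,K) = K_{k+1}` is Lipschitz on the small ball — torus data, raw constant
# ([ABKM19] Theorem 6.8 / Lemma 9.6 / Ch. 12 (12.4): the `σ`-Lipschitz hypothesis of the fine tuning)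

CH12-PLAN §5 (e3) of the crux line `gnv` (stub `stub_gnvOfFrd`): the Lipschitz estimate of the renormalisation map
`S(H,K) = K_{k+1}` of [ABKM19] Definition 6.5 on the small ball, for the concrete torus data.  The remainder
sums of `GradientRG.nextKStep_sub_opC_eq` were bounded with the extracted Hamiltonians `H̃, H̃'` as free
parameters (RenormalisationMapRemainderOne / TwoLarge / Three / Four); here `H̃ = nextH D H K = A_kH + B_kK`
and NextHamiltonianBounds (`‖H̃‖ ≤ 2b + v`, `‖H̃ − H̃'‖ ≤ 2‖H − H'‖ + v_Δ`, `v = C_{8.7}CA_𝒫A^{−1}`,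
`v_Δ = C_{8.7}C_ΔA_𝒫A^{−1}`) are substituted, so that every bound is expressed through `‖H‖,‖H'‖ ≤ b`,
`‖H − H'‖`, `‖K‖,‖K'‖ ≤ C`, `‖K − K'‖ ≤ C_Δ`.

* **`tayNormLE_remainderOne_sub_abkm_block`** — the block sum `Σ₁` in `L^d` form: its Lipschitz constant with
  `|U|_k` replaced by `L^d`, times `A·A^{−|U|_{k+1}}` (the sum is empty unless `U` is a single `(k+1)`-block);
* **`tayNormLE_nextKStep_sub_abkm_raw`** — for a connected `(k+1)`-polymer `U`:
  `|S(H,K)(U) − S(H',K')(U)|_{T_{k+1}^{U*}, w_{k+1}^U} ≤` [block part `C_Δ(θ₀ + 2ε)A^{−|U|_{k+1}}`]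
  `+` [`Σ₁` in `L^d` form] `+` [`Σ₂ᴸ`] `+` [`Σ₃`] `+` [`Σ₄`], from
  `S(H,K) − S(H',K') = [blockPart D K U − blockPart D K' U] + ΔΣ₁ + ΔΣ₂ᴸ + ΔΣ₃ + ΔΣ₄`
  (RenormalisationMapDecompositionABKM), the five Lipschitz bounds, and the `C^{r₀}` bookkeeping of
  RenormalisationMapSummandsSmooth.  The constant is left raw; its reduction to
  `(Θ_H‖H−H'‖_{k,0} + Θ_K C_Δ)·A^{−|U|_{k+1}}` (the form consumed by `RGFlow.IsRGStepQ.lipschitz`) is real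
  arithmetic (`pow_mul_rpow_le_inv_pow`, `|U|_k = L^d|U|_{k+1}`) done separately.

Everything is proved; no named fact.

## References
* S. Adams, S. Buchholz, R. Kotecký, S. Müller, arXiv:1910.13564, Theorem 6.8, Lemma 9.6, Lemma 10.1,
  Lemma 10.2, Ch. 12 (12.4) [AdamsBuchholzKoteckyMuller2019].
-/

noncomputable section

namespace Literature.MathematicalPhysics.StatisticalMechanics.GradientRG

open scoped BigOperators Classical
open Finset MeasureTheory
open Literature.MathematicalPhysics.StatisticalMechanics.TorusPolymer
  (IsPolymer blocks polys bprod blockOf thicken reblock boxCorner mem_polys mem_blocks numBlocks isPolymer_blockOf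
    card_blocks_eq_numBlocks blocks_blockOf empty_mem_polys closure)
open Literature.Barriers.CriticalPhenomena.LongRangePhi4.Polymer (IsConn components)
open Literature.MathematicalPhysics.StatisticalMechanics.GradientFRD (iterDiff)
open Literature.MathematicalPhysics.QuantumFieldTheory

variable {d M : ℕ} [NeZero M]

/-- **`Σ₁` on single `(k+1)`-blocks, `L^d` form**: the bound of `tayNormLE_remainderOne_sub_abkm` for
`H̃ = nextH D H K`, `H̃' = nextH D H' K'` (`‖H̃ − H̃'‖ ≤ 2‖H−H'‖ + v_Δ`, `‖H̃‖,‖H̃'‖ ≤ 2b + v` substituted) with the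
block count `|U|_k` replaced by `L^d` and multiplied by `A · A^{−|U|_{k+1}}`: the block sum is empty unless `U` is a
single `(k+1)`-block, where `|U|_k = L^d` and `A · A^{−|U|_{k+1}} = 1` — a constant uniform in `U`.
[cite: AdamsBuchholzKoteckyMuller2019, Theorem 6.8 / Lemma 9.6 (proof, first order)] -/
theorem tayNormLE_remainderOne_sub_abkm_block {L N Mord R n p r₀ : ℕ} {θbar lam μ δ₁ δ₀ A𝒫 h A : ℝ}
    {𝒞 : ℕ → (Fin d → ZMod M) → ℝ} (hd : 3 ≤ d) (hn : 2 ≤ n) (hLodd : Odd L) (hL : 2 ^ (d + 3) + 16 * R ≤ L)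
    (hR2 : 2 ≤ R) (hM : M = L ^ N) {k : ℕ} (hkN : k + 1 ≤ N)
    (hp1 : d / 2 + 1 ≤ p) (hpR : p ≤ R) (hMord : d / 2 + 1 ≤ Mord) (hr₀2 : 2 ≤ r₀)
    (hθbar : 0 < θbar) (hlam : 0 < lam)
    (hB : AbkmWeightBounds L N Mord R n θbar lam μ δ₁ δ₀ A𝒫 𝒞
      (abkmWeightData L N Mord R θbar (schedDelta δ₀ δ₁ N) 𝒞))
    (hδ₀ : 0 < δ₀) (hδ₁ : 0 < δ₁) (hh : 0 < h) (hh0 : hZeroSq d R δ₀ δ₁ ≤ h ^ 2)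
    {Cα : (Fin d → ℕ) → ℝ}
    (hCα : ∀ j, 1 ≤ j → j ≤ N + 1 → ∀ θ' : Fin d → ℕ, ∑ i, θ' i ≤ n →
      ∀ x, |iterDiff θ' (𝒞 j) x| ≤ Cα θ' / (L : ℝ) ^ ((j - 1) * (d - 2 + ∑ i, θ' i)))
    (hh2 : secondDiffConst Cα ≤ h ^ 2) (hA𝒫 : 0 ≤ A𝒫) (hA1 : 1 ≤ A)
    (D : StepData d M) (hDs : D.s = L ^ k) (hDL : D.L = L) (hD𝒞 : D.𝒞 = 𝒞 (k + 1))
    {x₀ : Fin d → ZMod M} (hB₀ : D.B₀ = blockOf (L ^ k) x₀) (hc₀ : D.c₀ = boxCorner (L ^ k) (starRad R L d k) x₀)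
    {U : Finset (Fin d → ZMod M)} (hU : IsPolymer (L ^ (k + 1)) U)
    {H H' : RelevantHamiltonian ℂ d} {b : ℝ}
    (hH : hamNorm (fieldWt h (L : ℝ) d k) ((L : ℝ) ^ k) (L ^ (d * k)) H ≤ b)
    (hH' : hamNorm (fieldWt h (L : ℝ) d k) ((L : ℝ) ^ k) (L ^ (d * k)) H' ≤ b) (hb : b ≤ 1 / 64)
    {K K' : Finset (Fin d → ZMod M) → ((Fin d → ZMod M) → ℝ) → ℂ} {C CΔ : ℝ} (hC : 0 ≤ C) (hCΔ : 0 ≤ CΔ)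
    (hK : WeakNormLE (abkmNormParams L N Mord R p r₀ h θbar A (schedDelta δ₀ δ₁ N) 𝒞) k K C)
    (hK' : WeakNormLE (abkmNormParams L N Mord R p r₀ h θbar A (schedDelta δ₀ δ₁ N) 𝒞) k K' C)
    (hΔ : WeakNormLE (abkmNormParams L N Mord R p r₀ h θbar A (schedDelta δ₀ δ₁ N) 𝒞) k (K - K') CΔ)
    (hKd : ∀ Y, ContDiff ℝ r₀ (K Y)) (hK'd : ∀ Y, ContDiff ℝ r₀ (K' Y))
    (hKloc : ∀ Y, IsPolymer (L ^ k) Y → IsConn Y → IsGaugeLocal ((abkmNormParams L N Mord R p r₀ h θbar A (schedDelta δ₀ δ₁ N) 𝒞).gauge k Y) (K Y))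
    (hK'loc : ∀ Y, IsPolymer (L ^ k) Y → IsConn Y → IsGaugeLocal ((abkmNormParams L N Mord R p r₀ h θbar A (schedDelta δ₀ δ₁ N) 𝒞).gauge k Y) (K' Y))
    (hv : pi2BoundConst d (((2 * R + 2 : ℕ) : ℝ) + ((d / 2 + 1 : ℕ) : ℝ)) * (C * A𝒫 * A⁻¹) ≤ 1 / 64)
    {κ : ℝ}
    (hκ1 : 1 + Real.exp (1 / 4) + 16 * Real.exp (3 / 8) * (2 * hamNorm (fieldWt h (L : ℝ) d k) ((L : ℝ) ^ k) (L ^ (d * k)) (H - H') + pi2BoundConst d (((2 * R + 2 : ℕ) : ℝ) + ((d / 2 + 1 : ℕ) : ℝ)) * (CΔ * A𝒫 * A⁻¹)) ≤ κ)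
    (hκ2 : 1 + Real.exp (1 / 4) + 16 * Real.exp (3 / 8) * (2 * b + pi2BoundConst d (((2 * R + 2 : ℕ) : ℝ) + ((d / 2 + 1 : ℕ) : ℝ)) * (C * A𝒫 * A⁻¹)) ≤ κ) :
    TayNormLE ((abkmNormParams L N Mord R p r₀ h θbar A (schedDelta δ₀ δ₁ N) 𝒞).gauge (k + 1) U) r₀ ((abkmWeightData L N Mord R θbar (schedDelta δ₀ δ₁ N) 𝒞).weight (k + 1) U)
      (fun φ => (∑ B ∈ blockPartIndex D U,
        ((bprod (L ^ k) (fun B' => expNegH (nextH D H K) B' φ) (U \ B) *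
              bprod (L ^ k) (fun B' => expNegH (-(nextH D H K)) B' φ) (B \ U) - 1) * blockTerm D K B φ +
          bprod (L ^ k) (fun B' => expNegH (nextH D H K) B' φ) (U \ B) *
              bprod (L ^ k) (fun B' => expNegH (-(nextH D H K)) B' φ) (B \ U) *
            (fluctDefect (𝒞 (k + 1)) H B φ +
              (expNegH (stepOpA (gradCov (𝒞 (k + 1))) H) B φ - 1) * (1 - Complex.exp (-(eval (opB D K) B φ))) -
              (Complex.exp (-(eval (opB D K) B φ)) - 1 + eval (opB D K) B φ)) +
          bprod (L ^ k) (fun B' => expNegH (nextH D H K) B' φ) (U \ B) *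
              bprod (L ^ k) (fun B' => expNegH (-(nextH D H K)) B' φ) (B \ U) *
            fluct (𝒞 (k + 1)) (fun ψ => ∑ Y ∈ ((polys (L ^ k) B).erase B).erase ∅,
              bprod (L ^ k) (fun B' => expNegH H B' ψ - 1) (B \ Y) * K Y ψ) φ)) -
        (∑ B ∈ blockPartIndex D U,
        ((bprod (L ^ k) (fun B' => expNegH (nextH D H' K') B' φ) (U \ B) *
              bprod (L ^ k) (fun B' => expNegH (-(nextH D H' K')) B' φ) (B \ U) - 1) * blockTerm D K' B φ +
          bprod (L ^ k) (fun B' => expNegH (nextH D H' K') B' φ) (U \ B) *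
              bprod (L ^ k) (fun B' => expNegH (-(nextH D H' K')) B' φ) (B \ U) *
            (fluctDefect (𝒞 (k + 1)) H' B φ +
              (expNegH (stepOpA (gradCov (𝒞 (k + 1))) H') B φ - 1) * (1 - Complex.exp (-(eval (opB D K') B φ))) -
              (Complex.exp (-(eval (opB D K') B φ)) - 1 + eval (opB D K') B φ)) +
          bprod (L ^ k) (fun B' => expNegH (nextH D H' K') B' φ) (U \ B) *
              bprod (L ^ k) (fun B' => expNegH (-(nextH D H' K')) B' φ) (B \ U) *
            fluct (𝒞 (k + 1)) (fun ψ => ∑ Y ∈ ((polys (L ^ k) B).erase B).erase ∅,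
              bprod (L ^ k) (fun B' => expNegH H' B' ψ - 1) (B \ Y) * K' Y ψ) φ)))
      (((L ^ d : ℕ) : ℝ) * κ ^ (L ^ d) * ((16 * Real.exp (3 / 8) * (2 * hamNorm (fieldWt h (L : ℝ) d k) ((L : ℝ) ^ k) (L ^ (d * k)) (H - H') + pi2BoundConst d (((2 * R + 2 : ℕ) : ℝ) + ((d / 2 + 1 : ℕ) : ℝ)) * (CΔ * A𝒫 * A⁻¹))) * (((1 + 8 * pi2BoundConst d (((2 * R + 2 : ℕ) : ℝ) + ((d / 2 + 1 : ℕ) : ℝ))) * (C * A𝒫 * A⁻¹)) + 256 * Real.exp (1 / 4) * ((A𝒫 + 4) * b ^ 2 + 2 * b * (pi2BoundConst d (((2 * R + 2 : ℕ) : ℝ) + ((d / 2 + 1 : ℕ) : ℝ)) * (C * A𝒫 * A⁻¹)) + (pi2BoundConst d (((2 * R + 2 : ℕ) : ℝ) + ((d / 2 + 1 : ℕ) : ℝ)) * (C * A𝒫 * A⁻¹)) ^ 2)) + 16 * Real.exp (3 / 8) * (2 * b + pi2BoundConst d (((2 * R + 2 : ℕ) : ℝ) + ((d / 2 + 1 :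 ℕ) : ℝ)) * (C * A𝒫 * A⁻¹)) * ((1 + 8 * pi2BoundConst d (((2 * R + 2 : ℕ) : ℝ) + ((d / 2 + 1 : ℕ) : ℝ))) * (CΔ * A𝒫 * A⁻¹)) + (512 * Real.exp (1 / 4) * (A𝒫 + 4) * (b + b) * hamNorm (fieldWt h (L : ℝ) d k) ((L : ℝ) ^ k) (L ^ (d * k)) (H - H') + 512 * Real.exp (1 / 4) * (hamNorm (fieldWt h (L : ℝ) d k) ((L : ℝ) ^ k) (L ^ (d * k)) (H - H') * (pi2BoundConst d (((2 * R + 2 : ℕ) : ℝ) + ((d / 2 + 1 : ℕ) : ℝ)) * (C * A𝒫 * A⁻¹)) + b * (pi2BoundConst d (((2 * R + 2 : ℕ) : ℝ) + ((d / 2 + 1 : ℕ) : ℝ)) * (CΔ * A𝒫 * A⁻¹))) + 256 * Real.exp (1 / 4) * (pi2BoundConst d (((2 * R + 2 : ℕ) : ℝ) + ((d / 2 + 1 : ℕ) : ℝ)) * (C * A𝒫 * A⁻¹) + pi2BoundConst d (((2 * R + 2 : ℕ) : ℝ) + ((d / 2 + 1 : ℕ) : ℝ)) * (CΔ * A𝒫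 * A⁻¹)) * (pi2BoundConst d (((2 * R + 2 : ℕ) : ℝ) + ((d / 2 + 1 : ℕ) : ℝ)) * (CΔ * A𝒫 * A⁻¹)))) * (A * (abkmNormParams L N Mord R p r₀ h θbar A (schedDelta δ₀ δ₁ N) 𝒞).aFactor (k + 1) U)) := by
  set P := abkmNormParams L N Mord R p r₀ h θbar A (schedDelta δ₀ δ₁ N) 𝒞 with hP
  set W := abkmWeightData L N Mord R θbar (schedDelta δ₀ δ₁ N) 𝒞 with hW
  have hd2 : 2 ≤ d := by omega
  have hL0 : (0 : ℝ) < L := by exact_mod_cast hLodd.pos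
  have hA0 : 0 < A := by linarith
  have hk1 : k + 1 ≤ N + 1 := by omega
  have h𝔥 : 0 < fieldWt h (L : ℝ) d k := fieldWt_pos hh hL0 d k
  have hRk : (0 : ℝ) < (L : ℝ) ^ k := by positivity
  have hnn : ∀ G : RelevantHamiltonian ℂ d, 0 ≤ hamNorm (fieldWt h (L : ℝ) d k) ((L : ℝ) ^ k) (L ^ (d * k)) G :=
    fun G => hamNorm_nonneg h𝔥.le hRk.le _ _
  have hb0 : 0 ≤ b := (hnn H).trans hH
  have hC87_0 : 0 ≤ pi2BoundConst d (((2 * R + 2 : ℕ) : ℝ) + ((d / 2 + 1 : ℕ) : ℝ)) := pi2BoundConst_nonneg d (by positivity)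
  have hAinv : 0 ≤ A⁻¹ := inv_nonneg.2 hA0.le
  have hv0 : 0 ≤ pi2BoundConst d (((2 * R + 2 : ℕ) : ℝ) + ((d / 2 + 1 : ℕ) : ℝ)) * (C * A𝒫 * A⁻¹) := by positivity
  have hvΔ0 : 0 ≤ pi2BoundConst d (((2 * R + 2 : ℕ) : ℝ) + ((d / 2 + 1 : ℕ) : ℝ)) * (CΔ * A𝒫 * A⁻¹) := by positivity
  have hnHH0 := hnn (H - H')
  have he38 : 0 ≤ 16 * Real.exp (3 / 8) := by positivity
  have he14 : 0 ≤ 8 * Real.exp (1 / 4) := by positivity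
  have hHt0 := hamNorm_nextH_abkm_le hd2 hn hLodd hL hM hkN hp1 hpR hr₀2 hθbar hlam hB hh hCα hh2 hA1 D hD𝒞 hB₀ hc₀ H
    hC hK hKd hKloc
  have hHt'0 := hamNorm_nextH_abkm_le hd2 hn hLodd hL hM hkN hp1 hpR hr₀2 hθbar hlam hB hh hCα hh2 hA1 D hD𝒞 hB₀ hc₀ H'
    hC hK' hK'd hK'loc
  have hΔle := hamNorm_nextH_sub_abkm_le hd2 hn hLodd hL hM hkN hp1 hpR hr₀2 hθbar hlam hB hh hCα hh2 hA1 D hD𝒞 hB₀ hc₀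
    H H' hC hC hCΔ hK hK' hΔ hKd hK'd hKloc hK'loc
  have hHt : hamNorm (fieldWt h (L : ℝ) d k) ((L : ℝ) ^ k) (L ^ (d * k)) (nextH D H K) ≤ (2 * b + pi2BoundConst d (((2 * R + 2 : ℕ) : ℝ) + ((d / 2 + 1 : ℕ) : ℝ)) * (C * A𝒫 * A⁻¹)) := by
    linarith [hHt0, hH]
  have hHt' : hamNorm (fieldWt h (L : ℝ) d k) ((L : ℝ) ^ k) (L ^ (d * k)) (nextH D H' K') ≤ (2 * b + pi2BoundConst d (((2 * R + 2 : ℕ) : ℝ) + ((d / 2 + 1 : ℕ) : ℝ)) * (C * A𝒫 * A⁻¹)) := by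
    linarith [hHt'0, hH']
  have hτ : (2 * b + pi2BoundConst d (((2 * R + 2 : ℕ) : ℝ) + ((d / 2 + 1 : ℕ) : ℝ)) * (C * A𝒫 * A⁻¹)) ≤ 1 / 16 := by linarith [hb, hv]
  have hτ0 : 0 ≤ (2 * b + pi2BoundConst d (((2 * R + 2 : ℕ) : ℝ) + ((d / 2 + 1 : ℕ) : ℝ)) * (C * A𝒫 * A⁻¹)) := by positivity
  have hΔt : 16 * Real.exp (3 / 8) * hamNorm (fieldWt h (L : ℝ) d k) ((L : ℝ) ^ k) (L ^ (d * k)) (nextH D H K - nextH D H' K') ≤ 16 * Real.exp (3 / 8) * (2 * hamNorm (fieldWt h (L : ℝ) d k) ((L : ℝ) ^ k) (L ^ (d * k)) (H - H') + pi2BoundConst d (((2 * R + 2 : ℕ) : ℝ) + ((d / 2 + 1 : ℕ) : ℝ)) * (CΔ * A𝒫 * A⁻¹)) :=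
    mul_le_mul_of_nonneg_left hΔle he38
  have hκ : 1 + Real.exp (1 / 4) + 16 * Real.exp (3 / 8) * hamNorm (fieldWt h (L : ℝ) d k) ((L : ℝ) ^ k) (L ^ (d * k)) (nextH D H K - nextH D H' K') ≤ κ := by
    linarith [hΔt, hκ1]
  have hκ0 : 0 ≤ κ := by
    have e1 : 0 ≤ 16 * Real.exp (3 / 8) * hamNorm (fieldWt h (L : ℝ) d k) ((L : ℝ) ^ k) (L ^ (d * k)) (nextH D H K - nextH D H' K') := mul_nonneg he38 (hnn _)
    linarith [hκ, Real.exp_pos (1 / 4)]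
  have hκm0 : 0 ≤ κ ^ (blocks (L ^ k) U).card := pow_nonneg hκ0 _
  have hDP0 : 0 ≤ 16 * Real.exp (3 / 8) * (2 * hamNorm (fieldWt h (L : ℝ) d k) ((L : ℝ) ^ k) (L ^ (d * k)) (H - H') + pi2BoundConst d (((2 * R + 2 : ℕ) : ℝ) + ((d / 2 + 1 : ℕ) : ℝ)) * (CΔ * A𝒫 * A⁻¹)) := by positivity
  have hMo : Odd M := by rw [hM]; exact hLodd.pow
  have hsodd : Odd (L ^ k) := hLodd.pow
  have hM00 : (0 : ℝ) ≤ ((blocks (L ^ k) U).card : ℝ) := Nat.cast_nonneg _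
  have hg1_0 : 0 ≤ ((1 + 8 * pi2BoundConst d (((2 * R + 2 : ℕ) : ℝ) + ((d / 2 + 1 : ℕ) : ℝ))) * (C * A𝒫 * A⁻¹)) := by positivity
  have hgΦ0 : 0 ≤ 256 * Real.exp (1 / 4) * ((A𝒫 + 4) * b ^ 2 + 2 * b * (pi2BoundConst d (((2 * R + 2 : ℕ) : ℝ) + ((d / 2 + 1 : ℕ) : ℝ)) * (C * A𝒫 * A⁻¹)) + (pi2BoundConst d (((2 * R + 2 : ℕ) : ℝ) + ((d / 2 + 1 : ℕ) : ℝ)) * (C * A𝒫 * A⁻¹)) ^ 2) := by positivity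
  have hg0 : 0 ≤ ((1 + 8 * pi2BoundConst d (((2 * R + 2 : ℕ) : ℝ) + ((d / 2 + 1 : ℕ) : ℝ))) * (C * A𝒫 * A⁻¹)) + 256 * Real.exp (1 / 4) * ((A𝒫 + 4) * b ^ 2 + 2 * b * (pi2BoundConst d (((2 * R + 2 : ℕ) : ℝ) + ((d / 2 + 1 : ℕ) : ℝ)) * (C * A𝒫 * A⁻¹)) + (pi2BoundConst d (((2 * R + 2 : ℕ) : ℝ) + ((d / 2 + 1 : ℕ) : ℝ)) * (C * A𝒫 * A⁻¹)) ^ 2) := add_nonneg hg1_0 hgΦ0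
  have hρ1_0 : 0 ≤ ((1 + 8 * pi2BoundConst d (((2 * R + 2 : ℕ) : ℝ) + ((d / 2 + 1 : ℕ) : ℝ))) * (CΔ * A𝒫 * A⁻¹)) := by positivity
  have hρΦ0 : 0 ≤ (512 * Real.exp (1 / 4) * (A𝒫 + 4) * (b + b) * hamNorm (fieldWt h (L : ℝ) d k) ((L : ℝ) ^ k) (L ^ (d * k)) (H - H') + 512 * Real.exp (1 / 4) * (hamNorm (fieldWt h (L : ℝ) d k) ((L : ℝ) ^ k) (L ^ (d * k)) (H - H') * (pi2BoundConst d (((2 * R + 2 : ℕ) : ℝ) + ((d / 2 + 1 : ℕ) : ℝ)) * (C * A𝒫 * A⁻¹)) + b * (pi2BoundConst d (((2 * R + 2 : ℕ) : ℝ) + ((d / 2 + 1 : ℕ) : ℝ)) * (CΔ * A𝒫 * A⁻¹))) + 256 * Real.exp (1 / 4) * (pi2BoundConst d (((2 * R + 2 : ℕ) : ℝ) + ((d / 2 + 1 : ℕ) : ℝ)) * (C * A𝒫 * A⁻¹) + pi2BoundConst d (((2 * R + 2 : ℕ) : ℝ) + ((d / 2 + 1 : ℕ) : ℝ)) * (CΔ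 * A𝒫 * A⁻¹)) * (pi2BoundConst d (((2 * R + 2 : ℕ) : ℝ) + ((d / 2 + 1 : ℕ) : ℝ)) * (CΔ * A𝒫 * A⁻¹))) := by positivity
  have h1 := tayNormLE_remainderOne_sub_abkm (p := p) (r₀ := r₀) (A := A) hd hn hLodd hL hR2 hM hkN hp1 hpR hMord hr₀2
    hθbar hlam hB hδ₀ hδ₁ hh hh0 hCα hh2 hA𝒫 hA1 D hDs hDL hD𝒞 hB₀ hc₀ hU hHt hHt' hτ hH hH' hb hC hCΔ hK hK' hΔ hKd hK'd
    hKloc hK'loc hv hκ hκ2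
  have h1' : TayNormLE (P.gauge (k + 1) U) r₀ (W.weight (k + 1) U) _ (((blocks (L ^ k) U).card : ℝ) * κ ^ (blocks (L ^ k) U).card * ((16 * Real.exp (3 / 8) * (2 * hamNorm (fieldWt h (L : ℝ) d k) ((L : ℝ) ^ k) (L ^ (d * k)) (H - H') + pi2BoundConst d (((2 * R + 2 : ℕ) : ℝ) + ((d / 2 + 1 : ℕ) : ℝ)) * (CΔ * A𝒫 * A⁻¹))) * (((1 + 8 * pi2BoundConst d (((2 * R + 2 : ℕ) : ℝ) + ((d / 2 + 1 : ℕ) : ℝ))) * (C * A𝒫 * A⁻¹)) + 256 * Real.exp (1 / 4) * ((A𝒫 + 4) * b ^ 2 + 2 * b * (pi2BoundConst d (((2 * R + 2 : ℕ) : ℝ) + ((d / 2 + 1 : ℕ) : ℝ)) * (C * A𝒫 * A⁻¹)) + (pi2BoundConst d (((2 * R + 2 : ℕ) : ℝ) + ((d / 2 + 1 : ℕ) : ℝ)) * (C * A𝒫 * A⁻¹)) ^ 2)) + 16 * Real.exp (3 / 8) * (2 * b + pi2BoundConst d (((2 * R + 2 : ℕ) : ℝ) + ((d / 2 + 1 :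 ℕ) : ℝ)) * (C * A𝒫 * A⁻¹)) * ((1 + 8 * pi2BoundConst d (((2 * R + 2 : ℕ) : ℝ) + ((d / 2 + 1 : ℕ) : ℝ))) * (CΔ * A𝒫 * A⁻¹)) + (512 * Real.exp (1 / 4) * (A𝒫 + 4) * (b + b) * hamNorm (fieldWt h (L : ℝ) d k) ((L : ℝ) ^ k) (L ^ (d * k)) (H - H') + 512 * Real.exp (1 / 4) * (hamNorm (fieldWt h (L : ℝ) d k) ((L : ℝ) ^ k) (L ^ (d * k)) (H - H') * (pi2BoundConst d (((2 * R + 2 : ℕ) : ℝ) + ((d / 2 + 1 : ℕ) : ℝ)) * (C * A𝒫 * A⁻¹)) + b * (pi2BoundConst d (((2 * R + 2 : ℕ) : ℝ) + ((d / 2 + 1 : ℕ) : ℝ)) * (CΔ * A𝒫 * A⁻¹))) + 256 * Real.exp (1 / 4) * (pi2BoundConst d (((2 * R + 2 : ℕ) : ℝ) + ((d / 2 + 1 : ℕ) : ℝ)) * (C * A𝒫 * A⁻¹) + pi2BoundConst d (((2 * R + 2 : ℕ) : ℝ) + ((d / 2 + 1 : ℕ) : ℝ)) * (CΔ * A𝒫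 * A⁻¹)) * (pi2BoundConst d (((2 * R + 2 : ℕ) : ℝ) + ((d / 2 + 1 : ℕ) : ℝ)) * (CΔ * A𝒫 * A⁻¹))))) :=
    h1.mono
    (by
      gcongr) (fun φ => (W.weight_pos (k + 1) U φ).le)
  have hLd0 : (0 : ℝ) ≤ ((L ^ d : ℕ) : ℝ) := Nat.cast_nonneg _
  have hS1_0 : 0 ≤ ((L ^ d : ℕ) : ℝ) * κ ^ (L ^ d) * ((16 * Real.exp (3 / 8) * (2 * hamNorm (fieldWt h (L : ℝ) d k) ((L : ℝ) ^ k) (L ^ (d * k)) (H - H') + pi2BoundConst d (((2 * R + 2 : ℕ) : ℝ) + ((d / 2 + 1 : ℕ) : ℝ)) * (CΔ * A𝒫 * A⁻¹))) * (((1 + 8 * pi2BoundConst d (((2 * R + 2 : ℕ) : ℝ) + ((d / 2 + 1 : ℕ) : ℝ))) * (C * A𝒫 * A⁻¹)) + 256 * Real.exp (1 / 4) * ((A𝒫 + 4) * b ^ 2 + 2 * b * (pi2BoundConst d (((2 * R + 2 : ℕ) : ℝ) + ((d / 2 + 1 : ℕ) : ℝ)) * (C * A𝒫 * A⁻¹))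 + (pi2BoundConst d (((2 * R + 2 : ℕ) : ℝ) + ((d / 2 + 1 : ℕ) : ℝ)) * (C * A𝒫 * A⁻¹)) ^ 2)) + 16 * Real.exp (3 / 8) * (2 * b + pi2BoundConst d (((2 * R + 2 : ℕ) : ℝ) + ((d / 2 + 1 : ℕ) : ℝ)) * (C * A𝒫 * A⁻¹)) * ((1 + 8 * pi2BoundConst d (((2 * R + 2 : ℕ) : ℝ) + ((d / 2 + 1 : ℕ) : ℝ))) * (CΔ * A𝒫 * A⁻¹)) + (512 * Real.exp (1 / 4) * (A𝒫 + 4) * (b + b) * hamNorm (fieldWt h (L : ℝ) d k) ((L : ℝ) ^ k) (L ^ (d * k)) (H - H') + 512 * Real.exp (1 / 4) * (hamNorm (fieldWt h (L : ℝ) d k) ((L : ℝ) ^ k) (L ^ (d * k)) (H - H') * (pi2BoundConst d (((2 * R + 2 : ℕ) : ℝ) + ((d / 2 + 1 : ℕ) : ℝ)) * (C * A𝒫 * A⁻¹)) + b * (pi2BoundConst d (((2 * R + 2 : ℕ) : ℝ) + ((d / 2 + 1 : ℕ) : ℝ)) * (CΔ * A𝒫 * A⁻¹))) + 256 * Real.exp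 (1 / 4) * (pi2BoundConst d (((2 * R + 2 : ℕ) : ℝ) + ((d / 2 + 1 : ℕ) : ℝ)) * (C * A𝒫 * A⁻¹) + pi2BoundConst d (((2 * R + 2 : ℕ) : ℝ) + ((d / 2 + 1 : ℕ) : ℝ)) * (CΔ * A𝒫 * A⁻¹)) * (pi2BoundConst d (((2 * R + 2 : ℕ) : ℝ) + ((d / 2 + 1 : ℕ) : ℝ)) * (CΔ * A𝒫 * A⁻¹)))) :=
    mul_nonneg (mul_nonneg hLd0 (pow_nonneg hκ0 _)) (add_nonneg (add_nonneg (mul_nonneg hDP0 hg0)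
      (mul_nonneg (mul_nonneg he38 hτ0) hρ1_0)) hρΦ0)
  by_cases hne : (blockPartIndex D U).Nonempty
  · obtain ⟨B, hB'⟩ := hne
    have hcl := (mem_filter.1 hB').2
    have hBb := (mem_filter.1 hB').1
    rw [hDs] at hBb
    obtain ⟨x, -, rfl⟩ := mem_blocks.1 hBb
    rw [hDs, hDL, closure_blockOf_mul hsodd hLodd x] at hcl
    have hcard1 : (blocks (L * L ^ k) U).card = 1 := by rw [← hcl, blocks_blockOf, card_singleton]
    have hnb : numBlocks (P.L ^ (k + 1)) U = 1 := by
      show numBlocks (L ^ (k + 1)) U = 1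
      rw [← card_blocks_eq_numBlocks, pow_succ', hcard1]
    have haF : A * P.aFactor (k + 1) U = 1 := by
      show A * (A ^ numBlocks (P.L ^ (k + 1)) U)⁻¹ = 1
      rw [hnb, pow_one, mul_inv_cancel₀ hA0.ne']
    have hMeq : M = L * L ^ k * L ^ (N - k - 1) := by
      rw [hM, ← pow_succ', ← pow_add]; congr 1; omega
    have hU' : IsPolymer (L * L ^ k) U := by rw [← pow_succ']; exact hU
    have hm0 : (blocks (L ^ k) U).card = L ^ d := by
      rw [TorusPolymer.card_blocks_eq_mul hMeq hsodd hLodd hLodd.pow hU', hcard1, mul_one]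
    rw [hm0] at h1'
    rw [haF, mul_one]
    exact h1'
  · rw [not_nonempty_iff_eq_empty] at hne
    intro φ
    have hF : (fun φ => (∑ B ∈ blockPartIndex D U,
        ((bprod (L ^ k) (fun B' => expNegH (nextH D H K) B' φ) (U \ B) *
              bprod (L ^ k) (fun B' => expNegH (-(nextH D H K)) B' φ) (B \ U) - 1) * blockTerm D K B φ +
          bprod (L ^ k) (fun B' => expNegH (nextH D H K) B' φ) (U \ B) *
              bprod (L ^ k) (fun B' => expNegH (-(nextH D H K)) B' φ) (B \ U) *
            (fluctDefect (𝒞 (k + 1)) H B φ +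
              (expNegH (stepOpA (gradCov (𝒞 (k + 1))) H) B φ - 1) * (1 - Complex.exp (-(eval (opB D K) B φ))) -
              (Complex.exp (-(eval (opB D K) B φ)) - 1 + eval (opB D K) B φ)) +
          bprod (L ^ k) (fun B' => expNegH (nextH D H K) B' φ) (U \ B) *
              bprod (L ^ k) (fun B' => expNegH (-(nextH D H K)) B' φ) (B \ U) *
            fluct (𝒞 (k + 1)) (fun ψ => ∑ Y ∈ ((polys (L ^ k) B).erase B).erase ∅,
              bprod (L ^ k) (fun B' => expNegH H B' ψ - 1) (B \ Y) * K Y ψ) φ)) -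
        (∑ B ∈ blockPartIndex D U,
        ((bprod (L ^ k) (fun B' => expNegH (nextH D H' K') B' φ) (U \ B) *
              bprod (L ^ k) (fun B' => expNegH (-(nextH D H' K')) B' φ) (B \ U) - 1) * blockTerm D K' B φ +
          bprod (L ^ k) (fun B' => expNegH (nextH D H' K') B' φ) (U \ B) *
              bprod (L ^ k) (fun B' => expNegH (-(nextH D H' K')) B' φ) (B \ U) *
            (fluctDefect (𝒞 (k + 1)) H' B φ +
              (expNegH (stepOpA (gradCov (𝒞 (k + 1))) H') B φ - 1) * (1 - Complex.exp (-(eval (opB D K') B φ))) -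
              (Complex.exp (-(eval (opB D K') B φ)) - 1 + eval (opB D K') B φ)) +
          bprod (L ^ k) (fun B' => expNegH (nextH D H' K') B' φ) (U \ B) *
              bprod (L ^ k) (fun B' => expNegH (-(nextH D H' K')) B' φ) (B \ U) *
            fluct (𝒞 (k + 1)) (fun ψ => ∑ Y ∈ ((polys (L ^ k) B).erase B).erase ∅,
              bprod (L ^ k) (fun B' => expNegH H' B' ψ - 1) (B \ Y) * K' Y ψ) φ))) = fun _ => (0 : ℂ) := by
      funext ψ; rw [hne, sum_empty, sum_empty, sub_zero]
    rw [hF, tayNorm_const, norm_zero]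
    exact mul_nonneg (mul_nonneg hS1_0 (mul_nonneg hA0.le (WeakNormLE.aFactor_pos hA0 (k + 1) U).le))
      (W.weight_pos (k + 1) U φ).le

set_option maxHeartbeats 400000 in
/-- **`S_k` is Lipschitz on the small ball (raw constant)** (module docstring): torus data at scale `k`
(`d ≥ 3`, `L` odd, `L ≥ 2^{d+3}+16R`, `R ≥ 2`, `M = L^N`, `k+1 ≤ N`, `⌊d/2⌋+2 ≤ p`, `p + d ≤ M_ord ≤ R`, `r₀ ≥ 3`,
kernel regularity with `h² ≥ secondDiffConst`, `h² ≥ h₀²`, `1 ≤ A`, `0 ≤ A_𝒫 ≤ A`, `2^{L^d}A_𝒫A^{−(1−1/η)} ≤ 1`),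
`U` a connected `(k+1)`-polymer, `‖H‖,‖H'‖ ≤ b ≤ 1/64`, admissible `K, K'` (factorising, `K(∅)=1`, local,
`C^{r₀}`, translation invariant) with `‖K‖,‖K'‖ ≤ C`, `‖K−K'‖ ≤ C_Δ`, `C_{8.7}CA_𝒫A^{−1} ≤ 1/64`.
[cite: AdamsBuchholzKoteckyMuller2019, Theorem 6.8 / Lemma 9.6 / Ch. 12 (12.4)] -/
theorem tayNormLE_nextKStep_sub_abkm_raw {L N Mord R n p r₀ : ℕ} {θbar lam μ δ₁ δ₀ A𝒫 h A : ℝ}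
    {𝒞 : ℕ → (Fin d → ZMod M) → ℝ} (hd : 3 ≤ d) (hn : 2 ≤ n) (hLodd : Odd L) (hL : 2 ^ (d + 3) + 16 * R ≤ L)
    (hR2 : 2 ≤ R) (hM : M = L ^ N) {k : ℕ} (hkN : k + 1 ≤ N)
    (hp : d / 2 + 2 ≤ p) (hpM : p + d ≤ Mord) (hMR : Mord ≤ R) (hr₀ : 3 ≤ r₀)
    (hθbar : 0 < θbar) (hlam : 0 < lam)
    (hB : AbkmWeightBounds L N Mord R n θbar lam μ δ₁ δ₀ A𝒫 𝒞
      (abkmWeightData L N Mord R θbar (schedDelta δ₀ δ₁ N) 𝒞))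
    (hδ₀ : 0 < δ₀) (hδ₁ : 0 < δ₁) (hh : 0 < h) (hh0 : hZeroSq d R δ₀ δ₁ ≤ h ^ 2)
    {Cα : (Fin d → ℕ) → ℝ}
    (hCα : ∀ j, 1 ≤ j → j ≤ N + 1 → ∀ θ' : Fin d → ℕ, ∑ i, θ' i ≤ n →
      ∀ x, |iterDiff θ' (𝒞 j) x| ≤ Cα θ' / (L : ℝ) ^ ((j - 1) * (d - 2 + ∑ i, θ' i)))
    (hh2 : secondDiffConst Cα ≤ h ^ 2) (hA𝒫 : 0 ≤ A𝒫) (hA1 : 1 ≤ A)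
    (hA𝒫A : A𝒫 ≤ A)
    (hsmall : (2 : ℝ) ^ (L ^ d) * (A𝒫 * A ^ (-(1 - (1 + 1 / ((2 * (2 ^ d + 1) + 6 : ℝ) ^ d))⁻¹) : ℝ)) ≤ 1)
    (D : StepData d M) (hDs : D.s = L ^ k) (hDL : D.L = L) (hD𝒞 : D.𝒞 = 𝒞 (k + 1))
    {x₀ : Fin d → ZMod M} (hB₀ : D.B₀ = blockOf (L ^ k) x₀) (hc₀ : D.c₀ = boxCorner (L ^ k) (starRad R L d k) x₀)
    {U : Finset (Fin d → ZMod M)} (hU : IsPolymer (L ^ (k + 1)) U)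
    (hUc : IsConn U)
    {H H' : RelevantHamiltonian ℂ d} {b : ℝ}
    (hH : hamNorm (fieldWt h (L : ℝ) d k) ((L : ℝ) ^ k) (L ^ (d * k)) H ≤ b)
    (hH' : hamNorm (fieldWt h (L : ℝ) d k) ((L : ℝ) ^ k) (L ^ (d * k)) H' ≤ b) (hb : b ≤ 1 / 64)
    {K K' : Finset (Fin d → ZMod M) → ((Fin d → ZMod M) → ℝ) → ℂ} {C CΔ : ℝ} (hC : 0 ≤ C) (hCΔ : 0 ≤ CΔ)
    (hK : WeakNormLE (abkmNormParams L N Mord R p r₀ h θbar A (schedDelta δ₀ δ₁ N) 𝒞) k K C)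
    (hK' : WeakNormLE (abkmNormParams L N Mord R p r₀ h θbar A (schedDelta δ₀ δ₁ N) 𝒞) k K' C)
    (hΔ : WeakNormLE (abkmNormParams L N Mord R p r₀ h θbar A (schedDelta δ₀ δ₁ N) 𝒞) k (K - K') CΔ)
    (hKfac : Factorises (L ^ k) K) (hK0 : ∀ φ, K ∅ φ = 1) (hK'fac : Factorises (L ^ k) K') (hK'0 : ∀ φ, K' ∅ φ = 1)
    (hKd : ∀ Y, ContDiff ℝ r₀ (K Y)) (hK'd : ∀ Y, ContDiff ℝ r₀ (K' Y))
    (hKloc : ∀ Y, IsPolymer (L ^ k) Y → IsConn Y → IsGaugeLocal ((abkmNormParams L N Mord R p r₀ h θbar A (schedDelta δ₀ δ₁ N) 𝒞).gauge k Y) (K Y))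
    (hK'loc : ∀ Y, IsPolymer (L ^ k) Y → IsConn Y → IsGaugeLocal ((abkmNormParams L N Mord R p r₀ h θbar A (schedDelta δ₀ δ₁ N) 𝒞).gauge k Y) (K' Y))
    (hKt : TransInv (L ^ k) K) (hK't : TransInv (L ^ k) K')
    (hv : pi2BoundConst d (((2 * R + 2 : ℕ) : ℝ) + ((d / 2 + 1 : ℕ) : ℝ)) * (C * A𝒫 * A⁻¹) ≤ 1 / 64)
    {ω : ℝ}
    (hω1 : 8 * Real.exp (1 / 4) * (2 * b + pi2BoundConst d (((2 * R + 2 : ℕ) : ℝ) + ((d / 2 + 1 : ℕ) : ℝ)) * (C * A𝒫 * A⁻¹)) + 16 * Real.exp (3 / 8) * (2 * hamNorm (fieldWt h (L : ℝ) d k) ((L : ℝ) ^ k) (L ^ (d * k)) (H - H') + pi2BoundConst d (((2 * R + 2 : ℕ) : ℝ) + ((d / 2 + 1 : ℕ) : ℝ)) * (CΔ * A𝒫 * A⁻¹)) ≤ ω)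
    (hω2 : 8 * Real.exp (1 / 4) * b + 16 * Real.exp (3 / 8) * hamNorm (fieldWt h (L : ℝ) d k) ((L : ℝ) ^ k) (L ^ (d * k)) (H - H') ≤ ω)
    (hω3 : C + CΔ ≤ ω) (hωA : ω * A ^ 2 ≤ 1)
    {κ : ℝ}
    (hκ1 : 1 + Real.exp (1 / 4) + 16 * Real.exp (3 / 8) * (2 * hamNorm (fieldWt h (L : ℝ) d k) ((L : ℝ) ^ k) (L ^ (d * k)) (H - H') + pi2BoundConst d (((2 * R + 2 : ℕ) : ℝ) + ((d / 2 + 1 : ℕ) : ℝ)) * (CΔ * A𝒫 * A⁻¹)) ≤ κ)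
    (hκ2 : 1 + Real.exp (1 / 4) + 16 * Real.exp (3 / 8) * (2 * b + pi2BoundConst d (((2 * R + 2 : ℕ) : ℝ) + ((d / 2 + 1 : ℕ) : ℝ)) * (C * A𝒫 * A⁻¹)) ≤ κ) :
    TayNormLE ((abkmNormParams L N Mord R p r₀ h θbar A (schedDelta δ₀ δ₁ N) 𝒞).gauge (k + 1) U) r₀ ((abkmWeightData L N Mord R θbar (schedDelta δ₀ δ₁ N) 𝒞).weight (k + 1) U)
      (fun φ => nextKStep D H K U φ - nextKStep D H' K' U φ)
      (CΔ * ((L : ℝ) ^ d * (A𝒫 * abkmContrConst d L R) + largePartEps d L A A𝒫 (1 + 1 / ((2 * (2 ^ d + 1) + 6 : ℝ) ^ d)) + largePartEps d L A A𝒫 (1 + 1 / ((2 * (2 ^ d + 1) + 6 : ℝ) ^ d))) * (abkmNormParams L N Mord R p r₀ h θbar A (schedDelta δ₀ δ₁ N) 𝒞).aFactor (k + 1) U +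
        ((L ^ d : ℕ) : ℝ) * κ ^ (L ^ d) * ((16 * Real.exp (3 / 8) * (2 * hamNorm (fieldWt h (L : ℝ) d k) ((L : ℝ) ^ k) (L ^ (d * k)) (H - H') + pi2BoundConst d (((2 * R + 2 : ℕ) : ℝ) + ((d / 2 + 1 : ℕ) : ℝ)) * (CΔ * A𝒫 * A⁻¹))) * (((1 + 8 * pi2BoundConst d (((2 * R + 2 : ℕ) : ℝ) + ((d / 2 + 1 : ℕ) : ℝ))) * (C * A𝒫 * A⁻¹)) + 256 * Real.exp (1 / 4) * ((A𝒫 + 4) * b ^ 2 + 2 * b * (pi2BoundConst d (((2 * R + 2 : ℕ) : ℝ) + ((d / 2 + 1 : ℕ) : ℝ)) * (C * A𝒫 * A⁻¹)) + (pi2BoundConst d (((2 * R + 2 : ℕ) : ℝ) + ((d / 2 + 1 : ℕ) : ℝ)) * (C * A𝒫 * A⁻¹)) ^ 2)) + 16 * Real.exp (3 / 8) * (2 * b + pi2BoundConst d (((2 * R + 2 : ℕ) : ℝ) + ((d / 2 + 1 : ℕ) : ℝ)) * (C * A𝒫 * A⁻¹)) * ((1 + 8 * pi2BoundConst d (((2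 * R + 2 : ℕ) : ℝ) + ((d / 2 + 1 : ℕ) : ℝ))) * (CΔ * A𝒫 * A⁻¹)) + (512 * Real.exp (1 / 4) * (A𝒫 + 4) * (b + b) * hamNorm (fieldWt h (L : ℝ) d k) ((L : ℝ) ^ k) (L ^ (d * k)) (H - H') + 512 * Real.exp (1 / 4) * (hamNorm (fieldWt h (L : ℝ) d k) ((L : ℝ) ^ k) (L ^ (d * k)) (H - H') * (pi2BoundConst d (((2 * R + 2 : ℕ) : ℝ) + ((d / 2 + 1 : ℕ) : ℝ)) * (C * A𝒫 * A⁻¹)) + b * (pi2BoundConst d (((2 * R + 2 : ℕ) : ℝ) + ((d / 2 + 1 : ℕ) : ℝ)) * (CΔ * A𝒫 * A⁻¹))) + 256 * Real.exp (1 / 4) * (pi2BoundConst d (((2 * R + 2 : ℕ) : ℝ) + ((d / 2 + 1 : ℕ) : ℝ)) * (C * A𝒫 * A⁻¹) + pi2BoundConst d (((2 * R + 2 : ℕ) : ℝ) + ((d / 2 + 1 : ℕ) : ℝ)) * (CΔ * A𝒫 * A⁻¹)) * (pi2BoundConst d (((2 * R + 2 : ℕ) : ℝ) + ((d / 2 +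 1 : ℕ) : ℝ)) * (CΔ * A𝒫 * A⁻¹)))) * (A * (abkmNormParams L N Mord R p r₀ h θbar A (schedDelta δ₀ δ₁ N) 𝒞).aFactor (k + 1) U) +
        (κ ^ (blocks (L ^ k) U).card * ((3 * (16 * Real.exp (3 / 8) * (2 * hamNorm (fieldWt h (L : ℝ) d k) ((L : ℝ) ^ k) (L ^ (d * k)) (H - H') + pi2BoundConst d (((2 * R + 2 : ℕ) : ℝ) + ((d / 2 + 1 : ℕ) : ℝ)) * (CΔ * A𝒫 * A⁻¹))) + 16 * Real.exp (3 / 8) * hamNorm (fieldWt h (L : ℝ) d k) ((L : ℝ) ^ k) (L ^ (d * k)) (H - H') + CΔ) * (ω * A ^ 4)) * (((2 * (2 * κ * max 1 A𝒫)) ^ ((2 ^ (d + 1) + 2) ^ d * L ^ d) * (4 : ℝ) ^ ((2 ^ (d + 1) + 2) ^ d * L ^ d)) ^ (blocks (L * L ^ k) U).card * A ^ (-((1 + 1 / ((2 * (2 ^ d + 1) + 6 : ℝ) ^ d)) * (blocks (L * L ^ k) U).card) : ℝ)) +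
          κ ^ (blocks (L ^ k) U).card * (2 * (16 * Real.exp (3 / 8) * (2 * hamNorm (fieldWt h (L : ℝ) d k) ((L : ℝ) ^ k) (L ^ (d * k)) (H - H') + pi2BoundConst d (((2 * R + 2 : ℕ) : ℝ) + ((d / 2 + 1 : ℕ) : ℝ)) * (CΔ * A𝒫 * A⁻¹))) + CΔ) * (((2 * κ * max 1 A𝒫) ^ ((2 ^ (d + 1) + 2) ^ d * L ^ d) * (2 : ℝ) ^ ((2 ^ (d + 1) + 2) ^ d * L ^ d)) ^ (blocks (L * L ^ k) U).card * A ^ (-((1 + 1 / ((2 * (2 ^ d + 1) + 6 : ℝ) ^ d)) * (blocks (L * L ^ k) U).card) : ℝ))) +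
        κ ^ (blocks (L ^ k) U).card * ((3 * (16 * Real.exp (3 / 8) * (2 * hamNorm (fieldWt h (L : ℝ) d k) ((L : ℝ) ^ k) (L ^ (d * k)) (H - H') + pi2BoundConst d (((2 * R + 2 : ℕ) : ℝ) + ((d / 2 + 1 : ℕ) : ℝ)) * (CΔ * A𝒫 * A⁻¹))) + 16 * Real.exp (3 / 8) * hamNorm (fieldWt h (L : ℝ) d k) ((L : ℝ) ^ k) (L ^ (d * k)) (H - H') + CΔ) * (ω * A ^ 4)) * (((2 * (2 * κ * max 1 A𝒫)) ^ ((2 ^ (d + 1) + 2) ^ d * L ^ d) * (4 : ℝ) ^ ((2 ^ (d + 1) + 2) ^ d * L ^ d)) ^ (blocks (L * L ^ k) U).card * A ^ (-((1 + 1 / ((2 * (2 ^ d + 1) + 6 : ℝ) ^ d)) * (blocks (L * L ^ k) U).card) : ℝ)) +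
        κ ^ (blocks (L ^ k) U).card * ((3 * (16 * Real.exp (3 / 8) * (2 * hamNorm (fieldWt h (L : ℝ) d k) ((L : ℝ) ^ k) (L ^ (d * k)) (H - H') + pi2BoundConst d (((2 * R + 2 : ℕ) : ℝ) + ((d / 2 + 1 : ℕ) : ℝ)) * (CΔ * A𝒫 * A⁻¹))) + 16 * Real.exp (3 / 8) * hamNorm (fieldWt h (L : ℝ) d k) ((L : ℝ) ^ k) (L ^ (d * k)) (H - H') + CΔ) * (ω * A ^ 4)) * (((2 * (2 * κ * max 1 A𝒫)) ^ ((2 ^ (d + 1) + 2) ^ d * L ^ d) * (4 : ℝ) ^ ((2 ^ (d + 1) + 2) ^ d * L ^ d)) ^ (blocks (L * L ^ k) U).card * A ^ (-((1 + 1 / ((2 * (2 ^ d + 1) + 6 : ℝ) ^ d)) * (blocks (L * L ^ k) U).card) : ℝ))) := by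
  set P := abkmNormParams L N Mord R p r₀ h θbar A (schedDelta δ₀ δ₁ N) 𝒞 with hP
  set W := abkmWeightData L N Mord R θbar (schedDelta δ₀ δ₁ N) 𝒞 with hW
  have hd2 : 2 ≤ d := by omega
  have hp1 : d / 2 + 1 ≤ p := by omega
  have hpR : p ≤ R := by omega
  have hMord : d / 2 + 1 ≤ Mord := by omega
  have hr₀2 : 2 ≤ r₀ := by omega
  have hL0 : (0 : ℝ) < L := by exact_mod_cast hLodd.pos
  have hA0 : 0 < A := by linarith
  have hk1 : k + 1 ≤ N + 1 := by omega
  have hUne : U.Nonempty := hUc.1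
  have hH8 : hamNorm (fieldWt h (L : ℝ) d k) ((L : ℝ) ^ k) (L ^ (d * k)) H ≤ 1 / 8 := by linarith [hH, hb]
  have hH'8 : hamNorm (fieldWt h (L : ℝ) d k) ((L : ℝ) ^ k) (L ^ (d * k)) H' ≤ 1 / 8 := by linarith [hH', hb]
  -- the five pieces
  have h0 := tayNormLE_blockPart_sub_abkm hd hLodd hL hM hkN hp hpM hMR hr₀ hθbar hlam hB hδ₀ hδ₁ hh hh0 hA𝒫 hA1 hA𝒫A
    hsmall D hDs hDL hD𝒞 hB₀ hc₀ hC hC hCΔ hK hK' hΔ hKt hK't hKd hK'd hKloc hK'loc hU hUc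
  have h1 := tayNormLE_remainderOne_sub_abkm_block hd hn hLodd hL hR2 hM hkN hp1 hpR hMord hr₀2 hθbar hlam hB hδ₀ hδ₁ hh
    hh0 hCα hh2 hA𝒫 hA1 D hDs hDL hD𝒞 hB₀ hc₀ hU hH hH' hb hC hCΔ hK hK' hΔ hKd hK'd hKloc hK'loc hv hκ1 hκ2
  have h2 := tayNormLE_remainderTwoLarge_sub_abkm_final hd hn hLodd hL hR2 hM hkN hp1 hpR hMord hr₀2 hθbar hlam hB hδ₀
    hδ₁ hh hh0 hCα hh2 hA𝒫 hA1 D hD𝒞 hB₀ hc₀ hU hH hH' hb hC hCΔ hK hK' hΔ hKfac hK0 hK'fac hK'0 hKd hK'd hKloc hK'loc hv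
    hω1 hω2 hω3 hωA hκ1
  have h3 := tayNormLE_remainderThree_sub_abkm_final hd hn hLodd hL hR2 hM hkN hp1 hpR hMord hr₀2 hθbar hlam hB hδ₀
    hδ₁ hh hh0 hCα hh2 hA𝒫 hA1 D hD𝒞 hB₀ hc₀ hU hUne hH hH' hb hC hCΔ hK hK' hΔ hKfac hK0 hK'fac hK'0 hKd hK'd hKloc
    hK'loc hv hω1 hω2 hω3 hωA hκ1
  have h4 := tayNormLE_remainderFour_sub_abkm_final hd hn hLodd hL hR2 hM hkN hp1 hpR hMord hr₀2 hθbar hlam hB hδ₀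
    hδ₁ hh hh0 hCα hh2 hA𝒫 hA1 D hD𝒞 hB₀ hc₀ hU hH hH' hb hC hCΔ hK hK' hΔ hKfac hK0 hK'fac hK'0 hKd hK'd hKloc hK'loc hv
    hω1 hω2 hω3 hωA hκ1
  -- smoothness of the five functionals
  have hUk : ∀ X ∈ ((polys (L ^ k) univ).filter (fun X => reblock (L ^ k) (L * L ^ k) X = U)), IsPolymer (L ^ k) X :=
    fun X hX => (mem_polys.1 (mem_filter.1 hX).1).2
  have hF0d : ContDiff ℝ r₀ (fun φ => blockPart D K U φ - blockPart D K' U φ) :=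
    (contDiff_blockPart_abkm hθbar hlam hB hLodd hM hk1 hA0 D hDs hD𝒞 hC hK hKd hKloc U).sub
      (contDiff_blockPart_abkm hθbar hlam hB hLodd hM hk1 hA0 D hDs hD𝒞 hC hK' hK'd hK'loc U)
  have hblk : ∀ B ∈ blockPartIndex D U, ∃ y, B = blockOf (L ^ k) y := fun B hB' => by
    have hBb := blockPartIndex_subset_blocks D U hB'
    rw [hDs] at hBb
    obtain ⟨y, -, rfl⟩ := mem_blocks.1 hBb
    exact ⟨y, rfl⟩
  have hF1d : ContDiff ℝ r₀ (fun φ => (∑ B ∈ blockPartIndex D U,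
        ((bprod (L ^ k) (fun B' => expNegH (nextH D H K) B' φ) (U \ B) *
              bprod (L ^ k) (fun B' => expNegH (-(nextH D H K)) B' φ) (B \ U) - 1) * blockTerm D K B φ +
          bprod (L ^ k) (fun B' => expNegH (nextH D H K) B' φ) (U \ B) *
              bprod (L ^ k) (fun B' => expNegH (-(nextH D H K)) B' φ) (B \ U) *
            (fluctDefect (𝒞 (k + 1)) H B φ +
              (expNegH (stepOpA (gradCov (𝒞 (k + 1))) H) B φ - 1) * (1 - Complex.exp (-(eval (opB D K) B φ))) -
              (Complex.exp (-(eval (opB D K) B φ)) - 1 + eval (opB D K) B φ)) +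
          bprod (L ^ k) (fun B' => expNegH (nextH D H K) B' φ) (U \ B) *
              bprod (L ^ k) (fun B' => expNegH (-(nextH D H K)) B' φ) (B \ U) *
            fluct (𝒞 (k + 1)) (fun ψ => ∑ Y ∈ ((polys (L ^ k) B).erase B).erase ∅,
              bprod (L ^ k) (fun B' => expNegH H B' ψ - 1) (B \ Y) * K Y ψ) φ)) -
        (∑ B ∈ blockPartIndex D U,
        ((bprod (L ^ k) (fun B' => expNegH (nextH D H' K') B' φ) (U \ B) *
              bprod (L ^ k) (fun B' => expNegH (-(nextH D H' K')) B' φ) (B \ U) - 1) * blockTerm D K' B φ +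
          bprod (L ^ k) (fun B' => expNegH (nextH D H' K') B' φ) (U \ B) *
              bprod (L ^ k) (fun B' => expNegH (-(nextH D H' K')) B' φ) (B \ U) *
            (fluctDefect (𝒞 (k + 1)) H' B φ +
              (expNegH (stepOpA (gradCov (𝒞 (k + 1))) H') B φ - 1) * (1 - Complex.exp (-(eval (opB D K') B φ))) -
              (Complex.exp (-(eval (opB D K') B φ)) - 1 + eval (opB D K') B φ)) +
          bprod (L ^ k) (fun B' => expNegH (nextH D H' K') B' φ) (U \ B) *
              bprod (L ^ k) (fun B' => expNegH (-(nextH D H' K')) B' φ) (B \ U) *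
            fluct (𝒞 (k + 1)) (fun ψ => ∑ Y ∈ ((polys (L ^ k) B).erase B).erase ∅,
              bprod (L ^ k) (fun B' => expNegH H' B' ψ - 1) (B \ Y) * K' Y ψ) φ))) := by
    refine (ContDiff.sum fun B hB' => ?_).sub (ContDiff.sum fun B hB' => ?_)
    · obtain ⟨y, rfl⟩ := hblk B hB'
      exact contDiff_blockSummand_abkm (p := p) (r₀ := r₀) (A := A) hd2 hθbar hlam hB hLodd hM hkN hδ₀ hδ₁ hh hh0 hMord hp1
        hA0 D hD𝒞 y (nextH D H K) hH8 hC hK hKd hKloc U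
    · obtain ⟨y, rfl⟩ := hblk B hB'
      exact contDiff_blockSummand_abkm (p := p) (r₀ := r₀) (A := A) hd2 hθbar hlam hB hLodd hM hkN hδ₀ hδ₁ hh hh0 hMord hp1
        hA0 D hD𝒞 y (nextH D H' K') hH'8 hC hK' hK'd hK'loc U
  have hF2d : ContDiff ℝ r₀ (fun φ => ∑ X ∈ largePartIndex (L ^ k) L U,
        (bprod (L ^ k) (fun B => expNegH (nextH D H K) B φ) (U \ X) * bprod (L ^ k) (fun B => expNegH (-(nextH D H K)) B φ) (X \ U) *
            (fluct (𝒞 (k + 1)) (polyP2 (L ^ k) H K X) φ + bprod (L ^ k) (fun B => 1 - expNegH (nextH D H K) B φ) X) -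
          bprod (L ^ k) (fun B => expNegH (nextH D H' K') B φ) (U \ X) * bprod (L ^ k) (fun B => expNegH (-(nextH D H' K')) B φ) (X \ U) *
            (fluct (𝒞 (k + 1)) (polyP2 (L ^ k) H' K' X) φ + bprod (L ^ k) (fun B => 1 - expNegH (nextH D H' K') B φ) X))) := by
    refine ContDiff.sum fun X hX => ?_
    obtain ⟨hXp, -, -, -⟩ := mem_largePartIndex.1 hX
    exact (contDiff_reblockTop_abkm hd2 hLodd hM hkN hp1 hMord hθbar hlam hB hδ₀ hδ₁ hh hh0 hA0 hXp (nextH D H K) hH8 hC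
      hK hKfac hK0 hKd hKloc U).sub
      (contDiff_reblockTop_abkm hd2 hLodd hM hkN hp1 hMord hθbar hlam hB hδ₀ hδ₁ hh hh0 hA0 hXp (nextH D H' K') hH'8 hC
        hK' hK'fac hK'0 hK'd hK'loc U)
  have hF3d : ContDiff ℝ r₀ (fun φ => ∑ X ∈ ((polys (L ^ k) univ).filter (fun X => reblock (L ^ k) (L * L ^ k) X = U)).filter
          (fun X => ¬ IsConn X),
        (bprod (L ^ k) (fun B => expNegH (nextH D H K) B φ) (U \ X) * bprod (L ^ k) (fun B => expNegH (-(nextH D H K)) B φ) (X \ U) *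
            (fluct (𝒞 (k + 1)) (polyP2 (L ^ k) H K X) φ + bprod (L ^ k) (fun B => 1 - expNegH (nextH D H K) B φ) X) -
          bprod (L ^ k) (fun B => expNegH (nextH D H' K') B φ) (U \ X) * bprod (L ^ k) (fun B => expNegH (-(nextH D H' K')) B φ) (X \ U) *
            (fluct (𝒞 (k + 1)) (polyP2 (L ^ k) H' K' X) φ + bprod (L ^ k) (fun B => 1 - expNegH (nextH D H' K') B φ) X))) := by
    refine ContDiff.sum fun X hX => ?_
    have hXp := hUk X (mem_filter.1 hX).1
    exact (contDiff_reblockTop_abkm hd2 hLodd hM hkN hp1 hMord hθbar hlam hB hδ₀ hδ₁ hh hh0 hA0 hXp (nextH D H K) hH8 hC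
      hK hKfac hK0 hKd hKloc U).sub
      (contDiff_reblockTop_abkm hd2 hLodd hM hkN hp1 hMord hθbar hlam hB hδ₀ hδ₁ hh hh0 hA0 hXp (nextH D H' K') hH'8 hC
        hK' hK'fac hK'0 hK'd hK'loc U)
  have hF4d : ContDiff ℝ r₀ (fun φ => ∑ X ∈ ((polys (L ^ k) univ).filter (fun X => reblock (L ^ k) (L * L ^ k) X = U)),
        ∑ X₁ ∈ ((polys (L ^ k) X).erase X).erase ∅,
        (bprod (L ^ k) (fun B => expNegH (nextH D H K) B φ) (U \ X) * bprod (L ^ k) (fun B => expNegH (-(nextH D H K)) B φ) (X \ U) *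
            (bprod (L ^ k) (fun B => 1 - expNegH (nextH D H K) B φ) X₁ * fluct (𝒞 (k + 1)) (polyP2 (L ^ k) H K (X \ X₁)) φ) -
          bprod (L ^ k) (fun B => expNegH (nextH D H' K') B φ) (U \ X) * bprod (L ^ k) (fun B => expNegH (-(nextH D H' K')) B φ) (X \ U) *
            (bprod (L ^ k) (fun B => 1 - expNegH (nextH D H' K') B φ) X₁ * fluct (𝒞 (k + 1)) (polyP2 (L ^ k) H' K' (X \ X₁)) φ))) := by
    refine ContDiff.sum fun X hX => ContDiff.sum fun X₁ hX₁ => ?_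
    have hXp := hUk X hX
    have hX₁p : X₁ ∈ polys (L ^ k) X := mem_of_mem_erase (mem_of_mem_erase hX₁)
    exact (contDiff_reblockSub_abkm hd2 hLodd hM hkN hp1 hMord hθbar hlam hB hδ₀ hδ₁ hh hh0 hA0 hXp hX₁p (nextH D H K) hH8
      hC hK hKfac hK0 hKd hKloc U).sub
      (contDiff_reblockSub_abkm hd2 hLodd hM hkN hp1 hMord hθbar hlam hB hδ₀ hδ₁ hh hh0 hA0 hXp hX₁p (nextH D H' K') hH'8
        hC hK' hK'fac hK'0 hK'd hK'loc U)
  have hsum := (((h0.add h1 hF0d hF1d).add h2 (hF0d.add hF1d) hF2d).add h3 ((hF0d.add hF1d).add hF2d) hF3d).add h4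
    (((hF0d.add hF1d).add hF2d).add hF3d) hF4d
  -- the decomposition of `S(H,K)(U)` and of `S(H',K')(U)`
  have hdec := nextKStep_eq_blockPart_add_remainders_abkm (p := p) (r₀ := r₀) (A := A) hd2 hLodd hL hM hkN hp1 hpR hMord
    hθbar hlam hB hδ₀ hδ₁ hh hh0 hA0 D hDs hDL hD𝒞 hB₀ hc₀ hH8 hC hK hKfac hK0 hKd hKloc hUne
  have hdec' := nextKStep_eq_blockPart_add_remainders_abkm (p := p) (r₀ := r₀) (A := A) hd2 hLodd hL hM hkN hp1 hpR hMord
    hθbar hlam hB hδ₀ hδ₁ hh hh0 hA0 D hDs hDL hD𝒞 hB₀ hc₀ hH'8 hC hK' hK'fac hK'0 hK'd hK'loc hUne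
  have hfun : (fun φ => nextKStep D H K U φ - nextKStep D H' K' U φ) =
      (fun φ => blockPart D K U φ - blockPart D K' U φ) + (fun φ => (∑ B ∈ blockPartIndex D U,
        ((bprod (L ^ k) (fun B' => expNegH (nextH D H K) B' φ) (U \ B) *
              bprod (L ^ k) (fun B' => expNegH (-(nextH D H K)) B' φ) (B \ U) - 1) * blockTerm D K B φ +
          bprod (L ^ k) (fun B' => expNegH (nextH D H K) B' φ) (U \ B) *
              bprod (L ^ k) (fun B' => expNegH (-(nextH D H K)) B' φ) (B \ U) *
            (fluctDefect (𝒞 (k + 1)) H B φ +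
              (expNegH (stepOpA (gradCov (𝒞 (k + 1))) H) B φ - 1) * (1 - Complex.exp (-(eval (opB D K) B φ))) -
              (Complex.exp (-(eval (opB D K) B φ)) - 1 + eval (opB D K) B φ)) +
          bprod (L ^ k) (fun B' => expNegH (nextH D H K) B' φ) (U \ B) *
              bprod (L ^ k) (fun B' => expNegH (-(nextH D H K)) B' φ) (B \ U) *
            fluct (𝒞 (k + 1)) (fun ψ => ∑ Y ∈ ((polys (L ^ k) B).erase B).erase ∅,
              bprod (L ^ k) (fun B' => expNegH H B' ψ - 1) (B \ Y) * K Y ψ) φ)) -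
        (∑ B ∈ blockPartIndex D U,
        ((bprod (L ^ k) (fun B' => expNegH (nextH D H' K') B' φ) (U \ B) *
              bprod (L ^ k) (fun B' => expNegH (-(nextH D H' K')) B' φ) (B \ U) - 1) * blockTerm D K' B φ +
          bprod (L ^ k) (fun B' => expNegH (nextH D H' K') B' φ) (U \ B) *
              bprod (L ^ k) (fun B' => expNegH (-(nextH D H' K')) B' φ) (B \ U) *
            (fluctDefect (𝒞 (k + 1)) H' B φ +
              (expNegH (stepOpA (gradCov (𝒞 (k + 1))) H') B φ - 1) * (1 - Complex.exp (-(eval (opB D K') B φ))) -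
              (Complex.exp (-(eval (opB D K') B φ)) - 1 + eval (opB D K') B φ)) +
          bprod (L ^ k) (fun B' => expNegH (nextH D H' K') B' φ) (U \ B) *
              bprod (L ^ k) (fun B' => expNegH (-(nextH D H' K')) B' φ) (B \ U) *
            fluct (𝒞 (k + 1)) (fun ψ => ∑ Y ∈ ((polys (L ^ k) B).erase B).erase ∅,
              bprod (L ^ k) (fun B' => expNegH H' B' ψ - 1) (B \ Y) * K' Y ψ) φ))) + (fun φ => ∑ X ∈ largePartIndex (L ^ k) L U,
        (bprod (L ^ k) (fun B => expNegH (nextH D H K) B φ) (U \ X) * bprod (L ^ k) (fun B => expNegH (-(nextH D H K)) B φ) (X \ U) *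
            (fluct (𝒞 (k + 1)) (polyP2 (L ^ k) H K X) φ + bprod (L ^ k) (fun B => 1 - expNegH (nextH D H K) B φ) X) -
          bprod (L ^ k) (fun B => expNegH (nextH D H' K') B φ) (U \ X) * bprod (L ^ k) (fun B => expNegH (-(nextH D H' K')) B φ) (X \ U) *
            (fluct (𝒞 (k + 1)) (polyP2 (L ^ k) H' K' X) φ + bprod (L ^ k) (fun B => 1 - expNegH (nextH D H' K') B φ) X))) + (fun φ => ∑ X ∈ ((polys (L ^ k) univ).filter (fun X => reblock (L ^ k) (L * L ^ k) X = U)).filter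
          (fun X => ¬ IsConn X),
        (bprod (L ^ k) (fun B => expNegH (nextH D H K) B φ) (U \ X) * bprod (L ^ k) (fun B => expNegH (-(nextH D H K)) B φ) (X \ U) *
            (fluct (𝒞 (k + 1)) (polyP2 (L ^ k) H K X) φ + bprod (L ^ k) (fun B => 1 - expNegH (nextH D H K) B φ) X) -
          bprod (L ^ k) (fun B => expNegH (nextH D H' K') B φ) (U \ X) * bprod (L ^ k) (fun B => expNegH (-(nextH D H' K')) B φ) (X \ U) *
            (fluct (𝒞 (k + 1)) (polyP2 (L ^ k) H' K' X) φ + bprod (L ^ k) (fun B => 1 - expNegH (nextH D H' K') B φ) X))) + (fun φ => ∑ X ∈ ((polys (L ^ k) univ).filter (fun X => reblock (L ^ k) (L * L ^ k) X = U)),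
        ∑ X₁ ∈ ((polys (L ^ k) X).erase X).erase ∅,
        (bprod (L ^ k) (fun B => expNegH (nextH D H K) B φ) (U \ X) * bprod (L ^ k) (fun B => expNegH (-(nextH D H K)) B φ) (X \ U) *
            (bprod (L ^ k) (fun B => 1 - expNegH (nextH D H K) B φ) X₁ * fluct (𝒞 (k + 1)) (polyP2 (L ^ k) H K (X \ X₁)) φ) -
          bprod (L ^ k) (fun B => expNegH (nextH D H' K') B φ) (U \ X) * bprod (L ^ k) (fun B => expNegH (-(nextH D H' K')) B φ) (X \ U) *
            (bprod (L ^ k) (fun B => 1 - expNegH (nextH D H' K') B φ) X₁ * fluct (𝒞 (k + 1)) (polyP2 (L ^ k) H' K' (X \ X₁)) φ))) := by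
    funext ψ
    simp only [Pi.add_apply]
    rw [hdec ψ, hdec' ψ]
    simp only [sum_sub_distrib]
    ring
  rw [hfun]
  exact hsum

end Literature.MathematicalPhysics.StatisticalMechanics.GradientRG

end
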